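import Mathlib
import Summits.ResolutionOfSingularities.ResolutionOfSingularities.Theorems.HomologicalConductorPersistenceKC3ChartClosedForm
import HarnessLib

/-!
# Crux `Persistence` (stmt-ResolutionOfSingularities-16484), KILL CANDIDATE K-C3, piece K3b-N″: THE DICTIONARY
# `k[a⁶, a⁴b, a³c, a²b², abc, c², b³] ≃ₐ[k] W = k[x, z, t, z²/x, zt/x, t²/x, z³/x²]` (`x = a⁶, z = a⁴b, t = a³c`)

Route `ResolutionOfSingularities/HomologicalConductor`, chain w44b (CHAIN v13.2 §V13.10 «CHART: A[I/x] = W := k[a,b,c]^{μ₆(1,2,3)} =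
k[a⁶, a⁴b, a³c, a²b², abc, c², b³] EXACTLY (dictionary x = a⁶, z = a⁴b, t = a³c, z²/x = a²b², zt/x = abc, t²/x = c², z³/x² = b³)»;
REFEREE-KC3 934cc3b7642bc99f L4).  [OURS · L1 w44b] — AI-written, weaker than expert review; not a statement of any manuscript
under review; no theorem here concludes the crux.

Both rings are modelled on ONE type `P := MvPolynomial (Fin 3) k` and its fraction field `K := FractionRing P`:
* `W ⊆ K` — `k[x, z, t, z²x⁻¹, ztx⁻¹, t²x⁻¹, z³x⁻¹x⁻¹]`, `x z t := ι X₀, ι X₁, ι X₂` (`ι = algebraMap P K`), spelled exactly as in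
  res-D-pv-043's `…PersistenceKC3TowerInstance.kc3_tower_one_eq` and in `…PersistenceKC3ChartClosedForm` / `…PersistenceKC3Normal`;
* `W₀ ⊆ P` — `k[X₀⁶, X₀⁴X₁, X₀³X₂, X₀²X₁², X₀X₁X₂, X₂², X₁³]` (`a b c := X₀, X₁, X₂`), the literal generator set of res-D-pv-037's
  `kc3W k` (W-model of record for the K4 Frobenius-order data, res-L1-w44b-plan-1 RE-CUT 2026-08-27T12:34:43Z (B)).

Results (def-free; the isomorphism is delivered in `∃`-form with its values on the seven generators):
* `aeval_dict_injective` — the substitution `θ₀ : X₀ ↦ X₀⁶, X₁ ↦ X₀⁴X₁, X₂ ↦ X₀³X₂` is injective on `k[X₀,X₁,X₂]` (it maps the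
  monomial of exponent `d` to the monomial of exponent `(6d₀ + 4d₁ + 3d₂, d₁, d₂)`, an injective map of exponents);
* `exists_dictHom` — a `k`-algebra endomorphism `θ` of the FIELD `K` with `θ x = x⁶, θ z = x⁴z, θ t = x³t`
  (`IsFractionRing.liftAlgHom`);
* `map_W_eq_map_W₀` — for every such `θ`: `W.map θ = W₀.map ι` inside `K`;
* `exists_algEquiv_W₀_W` — **`∃ e : ↥W₀ ≃ₐ[k] ↥W` with `e(a⁶) = x, e(a⁴b) = z, e(a³c) = t, e(a²b²) = z²x⁻¹, e(abc) = ztx⁻¹,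
  e(c²) = t²x⁻¹, e(b³) = z³x⁻¹x⁻¹`** — the σ-bridge socket at the level of `W` (res-type-010 K5 glue / res-D-pv-058 K4c /
  res-D-pv-037 K4d (iii)): through `e`, `T₁ = loc O W` is a localisation of `kc3W k`.

References: the dictionary is elementary; normality context [cite: BrunsHerzog1998, Prop. 6.1.2].
-/

-- single-problem summit: the doubled namespace component `ResolutionOfSingularities` is forced
set_option linter.dupNamespace false

noncomputable section

namespace Summit.ResolutionOfSingularities.ResolutionOfSingularities.Theorems.HomologicalConductor.PersistenceKC3Dictionary

open MvPolynomial
open Summit.ResolutionOfSingularities.ResolutionOfSingularities.Theorems.HomologicalConductor.PersistenceKC3ChartClosedForm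

variable {k : Type} [Field k]

local notation3 "𝕂" => FractionRing (MvPolynomial (Fin 3) k)
local notation3 "ι" => algebraMap (MvPolynomial (Fin 3) k) (FractionRing (MvPolynomial (Fin 3) k))
local notation3 "𝔵" => algebraMap (MvPolynomial (Fin 3) k) (FractionRing (MvPolynomial (Fin 3) k)) (MvPolynomial.X 0)
local notation3 "𝔷" => algebraMap (MvPolynomial (Fin 3) k) (FractionRing (MvPolynomial (Fin 3) k)) (MvPolynomial.X 1)
local notation3 "𝔱" => algebraMap (MvPolynomial (Fin 3) k) (FractionRing (MvPolynomial (Fin 3) k)) (MvPolynomial.X 2)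
/-- `W = k[x, z, t, z²x⁻¹, ztx⁻¹, t²x⁻¹, z³x⁻¹x⁻¹] ⊆ k(x,z,t)` (spelling of `kc3_tower_one_eq`; local notation only). -/
local notation3 "𝕎" => Algebra.adjoin k
  ({algebraMap (MvPolynomial (Fin 3) k) (FractionRing (MvPolynomial (Fin 3) k)) (MvPolynomial.X 0),
    algebraMap (MvPolynomial (Fin 3) k) (FractionRing (MvPolynomial (Fin 3) k)) (MvPolynomial.X 1),
    algebraMap (MvPolynomial (Fin 3) k) (FractionRing (MvPolynomial (Fin 3) k)) (MvPolynomial.X 2),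
    algebraMap (MvPolynomial (Fin 3) k) (FractionRing (MvPolynomial (Fin 3) k)) (MvPolynomial.X 1) ^ 2 *
      (algebraMap (MvPolynomial (Fin 3) k) (FractionRing (MvPolynomial (Fin 3) k)) (MvPolynomial.X 0))⁻¹,
    algebraMap (MvPolynomial (Fin 3) k) (FractionRing (MvPolynomial (Fin 3) k)) (MvPolynomial.X 1) *
      algebraMap (MvPolynomial (Fin 3) k) (FractionRing (MvPolynomial (Fin 3) k)) (MvPolynomial.X 2) *
      (algebraMap (MvPolynomial (Fin 3) k) (FractionRing (MvPolynomial (Fin 3) k)) (MvPolynomial.X 0))⁻¹,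
    algebraMap (MvPolynomial (Fin 3) k) (FractionRing (MvPolynomial (Fin 3) k)) (MvPolynomial.X 2) ^ 2 *
      (algebraMap (MvPolynomial (Fin 3) k) (FractionRing (MvPolynomial (Fin 3) k)) (MvPolynomial.X 0))⁻¹,
    algebraMap (MvPolynomial (Fin 3) k) (FractionRing (MvPolynomial (Fin 3) k)) (MvPolynomial.X 1) ^ 3 *
      (algebraMap (MvPolynomial (Fin 3) k) (FractionRing (MvPolynomial (Fin 3) k)) (MvPolynomial.X 0))⁻¹ *
      (algebraMap (MvPolynomial (Fin 3) k) (FractionRing (MvPolynomial (Fin 3) k)) (MvPolynomial.X 0))⁻¹} :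
    Set (FractionRing (MvPolynomial (Fin 3) k)))
/-- `W₀ = k[a⁶, a⁴b, a³c, a²b², abc, c², b³] ⊆ k[a,b,c]` — the literal generator set of res-D-pv-037's `kc3W k`
(local notation only). -/
local notation3 "𝕎₀" => Algebra.adjoin k
  ({MvPolynomial.X 0 ^ 6, MvPolynomial.X 0 ^ 4 * MvPolynomial.X 1, MvPolynomial.X 0 ^ 3 * MvPolynomial.X 2,
    MvPolynomial.X 0 ^ 2 * MvPolynomial.X 1 ^ 2, MvPolynomial.X 0 * MvPolynomial.X 1 * MvPolynomial.X 2,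
    MvPolynomial.X 2 ^ 2, MvPolynomial.X 1 ^ 3} : Set (MvPolynomial (Fin 3) k))
/-- The dictionary substitution `θ₀ : X₀ ↦ X₀⁶, X₁ ↦ X₀⁴X₁, X₂ ↦ X₀³X₂` (local notation only). -/
local notation3 "θ₀" => MvPolynomial.aeval (R := k) (S₁ := MvPolynomial (Fin 3) k)
  (![MvPolynomial.X 0 ^ 6, MvPolynomial.X 0 ^ 4 * MvPolynomial.X 1, MvPolynomial.X 0 ^ 3 * MvPolynomial.X 2] :
    Fin 3 → MvPolynomial (Fin 3) k)
/-- The exponent map of the dictionary, `d ↦ (6d₀ + 4d₁ + 3d₂, d₁, d₂)` (local notation only). -/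
local notation3 "φ" => fun d : Fin 3 →₀ ℕ =>
  Finsupp.single (0 : Fin 3) (6 * d 0 + 4 * d 1 + 3 * d 2) + Finsupp.single (1 : Fin 3) (d 1) +
    Finsupp.single (2 : Fin 3) (d 2)

/-! ## The substitution `θ₀` on monomials; injectivity -/

/-- `θ₀` maps the monomial of exponent `d` to the monomial of exponent `(6d₀ + 4d₁ + 3d₂, d₁, d₂)`. [folklore] -/
theorem aeval_dict_monomial (d : Fin 3 →₀ ℕ) (c : k) :
    θ₀ (monomial d c) = monomial (φ d) c := by
  rw [aeval_monomial, monomial_eq, MvPolynomial.algebraMap_eq, Finsupp.prod_fintype _ _ (by simp),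
    Finsupp.prod_fintype _ _ (by simp), Fin.prod_univ_three, Fin.prod_univ_three]
  simp only [Matrix.cons_val_zero, Matrix.cons_val_one, Matrix.cons_val, Finsupp.coe_add, Pi.add_apply,
    Finsupp.single_apply]
  simp only [Fin.isValue, ↓reduceIte, OfNat.ofNat_ne_one, Fin.zero_eq_one_iff,
    one_ne_zero, add_zero, zero_add, Fin.reduceEq]
  ring

/-- The exponent map of the dictionary is injective. [folklore] -/
theorem dict_exponent_eq_imp (d d' : Fin 3 →₀ ℕ) (h : (φ) d = (φ) d') : d = d' := by
  have h0 := congrArg (fun e : Fin 3 →₀ ℕ => e 0) h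
  have h1 := congrArg (fun e : Fin 3 →₀ ℕ => e 1) h
  have h2 := congrArg (fun e : Fin 3 →₀ ℕ => e 2) h
  simp only [Finsupp.coe_add, Pi.add_apply, Finsupp.single_apply] at h0 h1 h2
  simp only [Fin.isValue, ↓reduceIte, OfNat.ofNat_ne_one, Fin.zero_eq_one_iff,
    one_ne_zero, add_zero, zero_add, Fin.reduceEq] at h0 h1 h2
  ext i
  fin_cases i <;> simp only [Fin.zero_eta, Fin.isValue, Fin.mk_one, Fin.reduceFinMk] <;> omega

/-- Coefficient extraction: `coeff (φ d) (θ₀ f) = coeff d f`. [folklore] -/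
theorem coeff_dict_aeval (f : MvPolynomial (Fin 3) k) (d : Fin 3 →₀ ℕ) :
    coeff (φ d) (θ₀ f) = coeff d f := by
  conv_lhs => rw [f.as_sum, map_sum]
  simp only [aeval_dict_monomial, coeff_sum, coeff_monomial]
  rw [Finset.sum_eq_single d]
  · simp
  · intro e _ hne
    rw [if_neg]
    exact fun h => hne (dict_exponent_eq_imp _ _ h)
  · intro hd
    rw [if_pos rfl]
    exact notMem_support_iff.mp hd

/-- **The dictionary substitution `θ₀` is injective** on `k[X₀, X₁, X₂]`. [folklore] -/
theorem aeval_dict_injective : Function.Injective θ₀ := by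
  rw [injective_iff_map_eq_zero]
  intro f hf
  ext d
  rw [← coeff_dict_aeval f d, hf, coeff_zero, coeff_zero]

/-! ## The field endomorphism `θ` of `K = k(x,z,t)` extending `θ₀` -/

/-- **A `k`-algebra endomorphism of `K` with `θ x = x⁶`, `θ z = x⁴ z`, `θ t = x³ t`**, extending `θ₀` along `ι`
(`IsFractionRing.liftAlgHom` of the injective `ι ∘ θ₀`). [folklore] -/
theorem exists_dictHom : ∃ θ : 𝕂 →ₐ[k] 𝕂, (∀ p : MvPolynomial (Fin 3) k, θ (ι p) = ι (θ₀ p)) ∧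
    θ 𝔵 = 𝔵 ^ 6 ∧ θ 𝔷 = 𝔵 ^ 4 * 𝔷 ∧ θ 𝔱 = 𝔵 ^ 3 * 𝔱 := by
  let g : MvPolynomial (Fin 3) k →ₐ[k] 𝕂 := (IsScalarTower.toAlgHom k (MvPolynomial (Fin 3) k) 𝕂).comp θ₀
  have hg : Function.Injective g := algebraMap_injective.comp aeval_dict_injective
  have hval : ∀ p : MvPolynomial (Fin 3) k, IsFractionRing.liftAlgHom hg (ι p) = ι (θ₀ p) := fun p => by
    rw [IsFractionRing.liftAlgHom_apply, IsFractionRing.lift_algebraMap]; rfl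
  refine ⟨IsFractionRing.liftAlgHom hg, hval, ?_, ?_, ?_⟩
  · rw [hval, aeval_X]; simp
  · rw [hval, aeval_X]; simp
  · rw [hval, aeval_X]; simp

/-- The seven generator identities of the dictionary under any such `θ`: `θ(x) = ι(a⁶)`, …, `θ(z³x⁻¹x⁻¹) = ι(b³)`.
[folklore] -/
theorem dict_generators (θ : 𝕂 →ₐ[k] 𝕂) (hx : θ 𝔵 = 𝔵 ^ 6) (hz : θ 𝔷 = 𝔵 ^ 4 * 𝔷) (ht : θ 𝔱 = 𝔵 ^ 3 * 𝔱) :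
    θ 𝔵 = ι (X 0 ^ 6) ∧ θ 𝔷 = ι (X 0 ^ 4 * X 1) ∧ θ 𝔱 = ι (X 0 ^ 3 * X 2) ∧
    θ (𝔷 ^ 2 * 𝔵⁻¹) = ι (X 0 ^ 2 * X 1 ^ 2) ∧ θ (𝔷 * 𝔱 * 𝔵⁻¹) = ι (X 0 * X 1 * X 2) ∧
    θ (𝔱 ^ 2 * 𝔵⁻¹) = ι (X 2 ^ 2) ∧ θ (𝔷 ^ 3 * 𝔵⁻¹ * 𝔵⁻¹) = ι (X 1 ^ 3) := by
  have hx0 : (𝔵 : 𝕂) ≠ 0 := x_ne_zero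
  refine ⟨?_, ?_, ?_, ?_, ?_, ?_, ?_⟩
  · rw [hx, map_pow]
  · rw [hz, map_mul, map_pow]
  · rw [ht, map_mul, map_pow]
  · rw [map_mul, map_pow, map_inv₀, hx, hz, map_mul, map_pow, map_pow]
    field_simp
  · rw [map_mul, map_mul, map_inv₀, hx, hz, ht, map_mul, map_mul]
    field_simp
  · rw [map_mul, map_pow, map_inv₀, hx, ht, map_pow]
    field_simp
  · rw [map_mul, map_mul, map_pow, map_inv₀, hx, hz, map_pow]
    field_simp

/-- **`W.map θ = W₀.map ι`** inside `K`, for every `k`-algebra endomorphism `θ` of `K` realising the dictionary. [folklore] -/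
theorem map_W_eq_map_W₀ (θ : 𝕂 →ₐ[k] 𝕂) (hx : θ 𝔵 = 𝔵 ^ 6) (hz : θ 𝔷 = 𝔵 ^ 4 * 𝔷) (ht : θ 𝔱 = 𝔵 ^ 3 * 𝔱) :
    Subalgebra.map θ 𝕎 =
      Subalgebra.map (IsScalarTower.toAlgHom k (MvPolynomial (Fin 3) k) 𝕂) 𝕎₀ := by
  obtain ⟨h₁, h₂, h₃, h₄, h₅, h₆, h₇⟩ := dict_generators θ hx hz ht
  have hι : ∀ p : MvPolynomial (Fin 3) k, (IsScalarTower.toAlgHom k (MvPolynomial (Fin 3) k) 𝕂) p = ι p :=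
    fun p => rfl
  rw [AlgHom.map_adjoin, AlgHom.map_adjoin]
  apply le_antisymm
  · rw [Algebra.adjoin_le_iff]
    rintro y ⟨g, hg, rfl⟩
    simp only [Set.mem_insert_iff, Set.mem_singleton_iff] at hg
    apply Algebra.subset_adjoin
    rcases hg with rfl | rfl | rfl | rfl | rfl | rfl | rfl
    · exact ⟨X 0 ^ 6, by simp, by rw [hι, ← h₁]⟩
    · exact ⟨X 0 ^ 4 * X 1, by simp, by rw [hι, ← h₂]⟩
    · exact ⟨X 0 ^ 3 * X 2, by simp, by rw [hι, ← h₃]⟩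
    · exact ⟨X 0 ^ 2 * X 1 ^ 2, by simp, by rw [hι, ← h₄]⟩
    · exact ⟨X 0 * X 1 * X 2, by simp, by rw [hι, ← h₅]⟩
    · exact ⟨X 2 ^ 2, by simp, by rw [hι, ← h₆]⟩
    · exact ⟨X 1 ^ 3, by simp, by rw [hι, ← h₇]⟩
  · rw [Algebra.adjoin_le_iff]
    rintro y ⟨g, hg, rfl⟩
    simp only [Set.mem_insert_iff, Set.mem_singleton_iff] at hg
    apply Algebra.subset_adjoin
    rcases hg with rfl | rfl | rfl | rfl | rfl | rfl | rfl
    · exact ⟨𝔵, by simp, by rw [h₁, hι]⟩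
    · exact ⟨𝔷, by simp, by rw [h₂, hι]⟩
    · exact ⟨𝔱, by simp, by rw [h₃, hι]⟩
    · exact ⟨𝔷 ^ 2 * 𝔵⁻¹, by simp, by rw [h₄, hι]⟩
    · exact ⟨𝔷 * 𝔱 * 𝔵⁻¹, by simp, by rw [h₅, hι]⟩
    · exact ⟨𝔱 ^ 2 * 𝔵⁻¹, by simp, by rw [h₆, hι]⟩
    · exact ⟨𝔷 ^ 3 * 𝔵⁻¹ * 𝔵⁻¹, by simp, by rw [h₇, hι]⟩

/-! ## The dictionary isomorphism -/

set_option maxHeartbeats 400000 in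
/-- **THE DICTIONARY `e : k[a⁶, a⁴b, a³c, a²b², abc, c², b³] ≃ₐ[k] W = k[x, z, t, z²/x, zt/x, t²/x, z³/x²]`** with
`e(a⁶) = x, e(a⁴b) = z, e(a³c) = t, e(a²b²) = z²x⁻¹, e(abc) = ztx⁻¹, e(c²) = t²x⁻¹, e(b³) = z³x⁻¹x⁻¹`
(the left ring is the literal generator set of res-D-pv-037's `kc3W k` in `k[X₀,X₁,X₂]`; the right ring is the
`x`-chart `W ⊆ K = k(x,z,t)` of `kc3_tower_one_eq`). Construction: `W₀ ≃ W₀.map ι = W.map θ ≃ W` for the field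
endomorphism `θ` of `exists_dictHom`; the values are read off through the injectivity of `θ`. [folklore] -/
theorem exists_algEquiv_W₀_W :
    ∃ e : ↥𝕎₀ ≃ₐ[k] ↥𝕎,
      (∀ (h : (X 0 ^ 6 : MvPolynomial (Fin 3) k) ∈ 𝕎₀), (e ⟨X 0 ^ 6, h⟩ : 𝕂) = 𝔵) ∧
      (∀ (h : (X 0 ^ 4 * X 1 : MvPolynomial (Fin 3) k) ∈ 𝕎₀), (e ⟨X 0 ^ 4 * X 1, h⟩ : 𝕂) = 𝔷) ∧
      (∀ (h : (X 0 ^ 3 * X 2 : MvPolynomial (Fin 3) k) ∈ 𝕎₀), (e ⟨X 0 ^ 3 * X 2, h⟩ : 𝕂) = 𝔱) ∧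
      (∀ (h : (X 0 ^ 2 * X 1 ^ 2 : MvPolynomial (Fin 3) k) ∈ 𝕎₀), (e ⟨X 0 ^ 2 * X 1 ^ 2, h⟩ : 𝕂) = 𝔷 ^ 2 * 𝔵⁻¹) ∧
      (∀ (h : (X 0 * X 1 * X 2 : MvPolynomial (Fin 3) k) ∈ 𝕎₀), (e ⟨X 0 * X 1 * X 2, h⟩ : 𝕂) = 𝔷 * 𝔱 * 𝔵⁻¹) ∧
      (∀ (h : (X 2 ^ 2 : MvPolynomial (Fin 3) k) ∈ 𝕎₀), (e ⟨X 2 ^ 2, h⟩ : 𝕂) = 𝔱 ^ 2 * 𝔵⁻¹) ∧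
      (∀ (h : (X 1 ^ 3 : MvPolynomial (Fin 3) k) ∈ 𝕎₀), (e ⟨X 1 ^ 3, h⟩ : 𝕂) = 𝔷 ^ 3 * 𝔵⁻¹ * 𝔵⁻¹) ∧
      ∃ θ : 𝕂 →ₐ[k] 𝕂, (∀ p : MvPolynomial (Fin 3) k, θ (ι p) = ι (θ₀ p)) ∧
        ∀ w : ↥𝕎₀, θ (e w : 𝕂) = ι (w : MvPolynomial (Fin 3) k) := by
  obtain ⟨θ, hθι, hx, hz, ht⟩ := exists_dictHom (k := k)
  obtain ⟨h₁, h₂, h₃, h₄, h₅, h₆, h₇⟩ := dict_generators θ hx hz ht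
  have hθinj : Function.Injective θ := θ.toRingHom.injective
  have hιinj : Function.Injective (IsScalarTower.toAlgHom k (MvPolynomial (Fin 3) k) 𝕂) := algebraMap_injective
  let e₁ := Subalgebra.equivMapOfInjective 𝕎₀ (IsScalarTower.toAlgHom k (MvPolynomial (Fin 3) k) 𝕂) hιinj
  let e₂ := Subalgebra.equivOfEq _ _ (map_W_eq_map_W₀ θ hx hz ht).symm
  let e₃ := Subalgebra.equivMapOfInjective 𝕎 θ hθinj
  let e : ↥𝕎₀ ≃ₐ[k] ↥𝕎 := (e₁.trans e₂).trans e₃.symm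
  -- the defining property: `θ (e w) = ι w`
  have he : ∀ w : ↥𝕎₀, θ (e w : 𝕂) = ι (w : MvPolynomial (Fin 3) k) := by
    intro w
    have h3 : (e₃ (e w) : 𝕂) = θ (e w : 𝕂) := Subalgebra.coe_equivMapOfInjective_apply _ _ _ _
    rw [← h3]
    simp only [e, AlgEquiv.trans_apply, AlgEquiv.apply_symm_apply]
    rfl
  have hval : ∀ (w : ↥𝕎₀) (v : 𝕂), θ v = ι (w : MvPolynomial (Fin 3) k) → (e w : 𝕂) = v :=
    fun w v hv => hθinj (by rw [he, hv])
  refine ⟨e, ?_, ?_, ?_, ?_, ?_, ?_, ?_, θ, hθι, he⟩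
  · exact fun h => hval _ _ h₁
  · exact fun h => hval _ _ h₂
  · exact fun h => hval _ _ h₃
  · exact fun h => hval _ _ h₄
  · exact fun h => hval _ _ h₅
  · exact fun h => hval _ _ h₆
  · exact fun h => hval _ _ h₇

end Summit.ResolutionOfSingularities.ResolutionOfSingularities.Theorems.HomologicalConductor.PersistenceKC3Dictionary

end
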